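import Summits.CriticalPhenomena.SAWScalingLimit.Theses.SAWRestrictionRigidity
import Literature.Probability.RandomPlanarGeometry.RadoContinuity

/-!
# Stub `stub_radoExtensionDiscDP` of line `registered` (skeleton v6, mark-fixing cut), crux `Rigidity` (stmt-CriticalPhenomena-1368), route SAWRestrictionRigidity

Target: `Summits/CriticalPhenomena/SAWScalingLimit/Theorems/SAWRestrictionRigidityRigidityRadoExtensionDiscDP.lean`
(`--supports stmt-CriticalPhenomena-1368`).

**Radó extension at the disc, direction-preserving form.** For a chordal, Radó-continuous family
`P`, the transport identity `P (Φ D₀) = Φ_* P D₀` for two-marked unit discs `D₀ = (𝔻; a, b)` and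
DIRECTION-PRESERVING maps `Φ` (`Φ b - Φ a = r (b - a)`, `r > 0`) analytic and injective on an
open neighbourhood of the CLOSED disc extends to every direction-preserving `Φ : C(ℂ, ℂ)` that is
complex differentiable on the open disc and injective on the closed disc. Proof: the dilates
`Ψₙ = Φ (rₙ ·)`, `rₙ = 1 - 1/(n+2) ↑ 1`, are complex differentiable and injective on the open disc
of radius `1/rₙ ⊃ closedBall 0 1` and converge to `Φ` uniformly on the closed disc; the
complex-AFFINE corrections `Aₙ z = cₙ z + wₙ`, `cₙ = (Φ b - Φ a)/(Ψₙ b - Ψₙ a) → 1`,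
`wₙ = Φ a - cₙ Ψₙ a → 0`, re-pin the two image marks: `Φₙ := Aₙ ∘ Ψₙ` satisfies `Φₙ a = Φ a`,
`Φₙ b = Φ b` for every `n` (so `Φₙ` is direction-preserving with the same `r`), is analytic and
injective where `Ψₙ` is, and still `Φₙ → Φ` uniformly on the closed disc. With `Dₙ = Φₙ (D₀)`
(`MarkedDomain.image`, marks `Φ a, Φ b`) the hypothesis gives `P Dₙ = (Φₙ)_* P D₀`; dominated
convergence on the compact traces gives `(Φₙ)_* P D₀ ⇀ Φ_* P D₀`, Radó continuity gives
`P Dₙ ⇀ P D'`, and weak limits of finite Borel laws on the metric space `CurveClass ℂ` are unique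
(`MeasureTheory.ext_of_forall_integral_eq_of_IsFiniteMeasure`). Structure copied from the landed
`Dichotomy.stub_radoExtensionDisc` (p168392).

References: P. Billingsley, *Convergence of Probability Measures* (2nd ed., 1999), Thm. 1.2
(bounded continuous test functions determine a finite Borel law on a metric space);
Ch. Pommerenke, *Boundary Behaviour of Conformal Maps* (1992), §2.3 (Radó's theorem, the name).
-/

noncomputable section

namespace Summit.CriticalPhenomena.SAWScalingLimit.Cruxes.Rigidity.MarkFixing

open MeasureTheory Set Filter Topology Metric
open Literature.Probability.RandomPlanarGeometry
open scoped BoundedContinuousFunction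

/-- **Push-forwards along uniformly convergent maps converge weakly.** If `μ` is a finite law on
curve classes almost every one of which has its trace in `K`, and `Φₙ → Φ` uniformly on `K`, then
`(Φₙ)_* μ ⇀ Φ_* μ`: `∫ f d((Φₙ)_* μ) = ∫ f (Φₙ ∘ γ) dμ → ∫ f (Φ ∘ γ) dμ` by dominated convergence
(`|f| ≤ ‖f‖`, and `Φₙ ∘ γ → Φ ∘ γ` in curve space for `γ ⊆ K`,
`CurveClass.tendsto_map_of_tendstoUniformlyOn`). [folklore] -/
private theorem tendsto_integral_map_of_unif {μ : Measure (CurveClass ℂ)}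
    [IsFiniteMeasure μ] {K : Set ℂ} (hK : ∀ᵐ γ ∂μ, CurveClass.range γ ⊆ K) {Φ : C(ℂ, ℂ)}
    {Φn : ℕ → C(ℂ, ℂ)} (hunif : TendstoUniformlyOn (fun n ↦ ⇑(Φn n)) Φ atTop K)
    (f : CurveClass ℂ →ᵇ ℝ) :
    Tendsto (fun n ↦ ∫ γ, f γ ∂(μ.map (CurveClass.map (Φn n)))) atTop
      (𝓝 (∫ γ, f γ ∂(μ.map (CurveClass.map Φ)))) := by
  have hint : ∀ Ψ : C(ℂ, ℂ),
      ∫ γ, f γ ∂(μ.map (CurveClass.map Ψ)) = ∫ γ, f (CurveClass.map Ψ γ) ∂μ := fun Ψ ↦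
    integral_map (CurveClass.measurable_map Ψ).aemeasurable f.continuous.aestronglyMeasurable
  simp_rw [hint]
  refine tendsto_integral_of_dominated_convergence (fun _ ↦ ‖f‖)
    (fun n ↦ (f.continuous.comp (CurveClass.continuous_map _)).aestronglyMeasurable)
    (integrable_const _) (fun n ↦ Eventually.of_forall fun γ ↦ f.norm_coe_le_norm _) ?_
  filter_upwards [hK] with γ hγ
  exact (f.continuous.tendsto _).comp (CurveClass.tendsto_map_of_tendstoUniformlyOn hunif γ hγ)

/-- **Analytic dilates on the closed unit disc.** A continuous plane map `Φ` that is complex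
differentiable on the open unit disc and injective on the closed unit disc is the uniform limit on
the closed unit disc of the dilates `Ψₙ = Φ (rₙ ·)` (`rₙ = 1 - 1/(n+2)`), each complex
differentiable and injective on the open disc `Uₙ` of radius `1/rₙ > 1` (chain rule; `z ↦ rₙ z`
maps `Uₙ` injectively into the open unit disc), and `‖Φ (rₙ z) - Φ z‖` is uniformly small for
`‖z‖ ≤ 1` because `‖rₙ z - z‖ ≤ 1 - rₙ → 0` and `Φ` is uniformly continuous on the compact closed
disc. Verbatim the approximation lemma of p168392. [folklore] -/
private theorem exists_dilates_closedBall (Φ : C(ℂ, ℂ))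
    (hΦd : DifferentiableOn ℂ Φ (ball (0 : ℂ) 1)) (hΦi : InjOn Φ (closedBall (0 : ℂ) 1)) :
    ∃ (Φn : ℕ → C(ℂ, ℂ)) (U : ℕ → Set ℂ), (∀ n, IsOpen (U n)) ∧
      (∀ n, closedBall (0 : ℂ) 1 ⊆ U n) ∧ (∀ n, DifferentiableOn ℂ (Φn n) (U n)) ∧
      (∀ n, InjOn (Φn n) (U n)) ∧
      TendstoUniformlyOn (fun n ↦ ⇑(Φn n)) Φ atTop (closedBall (0 : ℂ) 1) := by
  -- the radii `rₙ = 1 - 1/(n+2) ∈ (0, 1)`, `1 - rₙ → 0`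
  set r : ℕ → ℝ := fun n ↦ 1 - 1 / ((n : ℝ) + 2) with hr
  have hr0 : ∀ n, 0 < r n := fun n ↦ by
    have h2 : (0 : ℝ) < (n : ℝ) + 2 := by positivity
    have h3 : 1 / ((n : ℝ) + 2) < 1 := by
      rw [div_lt_one h2]
      linarith
    simp only [hr]
    linarith
  have hr1 : ∀ n, r n < 1 := fun n ↦ by
    have h3 : (0 : ℝ) < 1 / ((n : ℝ) + 2) := by positivity
    simp only [hr]
    linarith
  have hr_tend : Tendsto (fun n ↦ 1 - r n) atTop (𝓝 0) := by
    have h : Tendsto (fun n : ℕ ↦ 1 / ((n : ℝ) + 2)) atTop (𝓝 0) :=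
      tendsto_const_nhds.div_atTop
        (tendsto_atTop_add_const_right _ _ tendsto_natCast_atTop_atTop)
    refine h.congr fun n ↦ ?_
    simp only [hr]
    ring
  -- the scalings `z ↦ rₙ z`
  set S : ℕ → C(ℂ, ℂ) := fun n ↦ ⟨fun z ↦ (r n : ℂ) * z, by fun_prop⟩ with hS
  have hS_apply : ∀ n z, S n z = (r n : ℂ) * z := fun n z ↦ rfl
  have hSmaps : ∀ n, MapsTo (S n) (ball (0 : ℂ) (1 / r n)) (ball (0 : ℂ) 1) := fun n z hz ↦ by
    rw [mem_ball_zero_iff] at hz ⊢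
    rw [hS_apply, norm_mul, Complex.norm_of_nonneg (hr0 n).le]
    calc r n * ‖z‖ < r n * (1 / r n) := mul_lt_mul_of_pos_left hz (hr0 n)
      _ = 1 := mul_one_div_cancel (hr0 n).ne'
  have hSd : ∀ n, DifferentiableOn ℂ (S n) (ball (0 : ℂ) (1 / r n)) := fun n ↦
    Differentiable.differentiableOn (by simp only [funext (hS_apply n)]; fun_prop)
  have hSi : ∀ n, InjOn (S n) (ball (0 : ℂ) (1 / r n)) := fun n ↦ by
    refine Function.Injective.injOn ?_
    simp only [funext (hS_apply n)]
    exact mul_right_injective₀ (Complex.ofReal_ne_zero.2 (hr0 n).ne')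
  refine ⟨fun n ↦ Φ.comp (S n), fun n ↦ ball (0 : ℂ) (1 / r n), fun n ↦ isOpen_ball,
    fun n ↦ closedBall_subset_ball (one_lt_one_div (hr0 n) (hr1 n)),
    fun n ↦ (hΦd.comp (hSd n) (hSmaps n) :), fun n ↦ ?_, ?_⟩
  · exact (hΦi.mono ball_subset_closedBall).comp (hSi n) (hSmaps n)
  · -- uniform convergence on the closed unit disc
    rw [Metric.tendstoUniformlyOn_iff]
    intro ε hε
    obtain ⟨δ, hδ, hδε⟩ := Metric.uniformContinuousOn_iff.1
      ((isCompact_closedBall (0 : ℂ) 1).uniformContinuousOn_of_continuous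
        Φ.continuous.continuousOn) ε hε
    filter_upwards [hr_tend.eventually (eventually_lt_nhds hδ)] with n hn x hx
    have hx' : ‖x‖ ≤ 1 := mem_closedBall_zero_iff.1 hx
    rw [ContinuousMap.comp_apply, hS_apply]
    refine hδε x hx ((r n : ℂ) * x) ?_ ?_
    · rw [mem_closedBall_zero_iff, norm_mul, Complex.norm_of_nonneg (hr0 n).le]
      calc r n * ‖x‖ ≤ 1 * 1 := mul_le_mul (hr1 n).le hx' (norm_nonneg _) zero_le_one
        _ = 1 := one_mul 1
    · rw [dist_eq_norm]
      have hxe : x - (r n : ℂ) * x = ((1 - r n : ℝ) : ℂ) * x := by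
        push_cast
        ring
      rw [hxe, norm_mul, Complex.norm_of_nonneg (sub_nonneg.2 (hr1 n).le)]
      calc (1 - r n) * ‖x‖ ≤ (1 - r n) * 1 :=
            mul_le_mul_of_nonneg_left hx' (sub_nonneg.2 (hr1 n).le)
        _ < δ := by rw [mul_one]; exact hn

/-- **Re-pinning two values by complex-affine corrections.** Let `Φ` be injective on a compact set
`K ∋ p, q` (`p ≠ q`) and let `Ψₙ → Φ` uniformly on `K`, each `Ψₙ` complex differentiable and
injective on a set `Uₙ ⊇ K`. With `cₙ := (Φ q - Φ p)/(Ψₙ q - Ψₙ p)` (both differences are nonzero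
by injectivity) and `wₙ := Φ p - cₙ Ψₙ p`, the maps `Φₙ z := cₙ Ψₙ z + wₙ` satisfy `Φₙ p = Φ p`,
`Φₙ q = Φ q`, are complex differentiable and injective on `Uₙ` (`cₙ ≠ 0`), and `Φₙ → Φ`
uniformly on `K`: `cₙ → 1`, `wₙ → 0` (pointwise convergence at `p, q`), and
`‖Φ z - Φₙ z‖ ≤ ‖Φ z - Ψₙ z‖ + ‖1 - cₙ‖ (M + 1) + ‖wₙ‖` for `z ∈ K` once `‖Ψₙ - Φ‖ < 1` on `K`,
`M` a bound for `Φ` on `K`. [folklore] -/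
private theorem exists_pinned_approx (Φ : C(ℂ, ℂ)) {K : Set ℂ} (hK : IsCompact K)
    (hΦi : InjOn Φ K) {p q : ℂ} (hp : p ∈ K) (hq : q ∈ K) (hpq : p ≠ q) (Ψ : ℕ → C(ℂ, ℂ))
    (U : ℕ → Set ℂ) (hU : ∀ n, K ⊆ U n) (hd : ∀ n, DifferentiableOn ℂ (Ψ n) (U n))
    (hi : ∀ n, InjOn (Ψ n) (U n)) (hunif : TendstoUniformlyOn (fun n ↦ ⇑(Ψ n)) Φ atTop K) :
    ∃ Φn : ℕ → C(ℂ, ℂ), (∀ n, DifferentiableOn ℂ (Φn n) (U n)) ∧ (∀ n, InjOn (Φn n) (U n)) ∧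
      (∀ n, Φn n p = Φ p) ∧ (∀ n, Φn n q = Φ q) ∧
      TendstoUniformlyOn (fun n ↦ ⇑(Φn n)) Φ atTop K := by
  have hΨp : Tendsto (fun n ↦ Ψ n p) atTop (𝓝 (Φ p)) := hunif.tendsto_at hp
  have hΨq : Tendsto (fun n ↦ Ψ n q) atTop (𝓝 (Φ q)) := hunif.tendsto_at hq
  have hnum : Φ q - Φ p ≠ 0 := sub_ne_zero.2 fun h ↦ hpq (hΦi hp hq h.symm)
  have hden : ∀ n, Ψ n q - Ψ n p ≠ 0 := fun n ↦
    sub_ne_zero.2 fun h ↦ hpq (hi n (hU n hp) (hU n hq) h.symm)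
  -- the affine corrections `A n z = c n * z + w n`
  set c : ℕ → ℂ := fun n ↦ (Φ q - Φ p) / (Ψ n q - Ψ n p) with hc_def
  have hc0 : ∀ n, c n ≠ 0 := fun n ↦ div_ne_zero hnum (hden n)
  have hcq : ∀ n, c n * (Ψ n q - Ψ n p) = Φ q - Φ p := fun n ↦ div_mul_cancel₀ _ (hden n)
  have hc1 : Tendsto c atTop (𝓝 1) := by
    have h := (tendsto_const_nhds : Tendsto (fun _ : ℕ ↦ Φ q - Φ p) atTop (𝓝 (Φ q - Φ p))).div
      (hΨq.sub hΨp) hnum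
    rw [div_self hnum] at h
    exact h
  set w : ℕ → ℂ := fun n ↦ Φ p - c n * Ψ n p with hw_def
  have hw0 : Tendsto w atTop (𝓝 0) := by
    have h := (tendsto_const_nhds : Tendsto (fun _ : ℕ ↦ Φ p) atTop (𝓝 (Φ p))).sub
      (hc1.mul hΨp)
    rw [one_mul, sub_self] at h
    exact h
  set A : ℕ → C(ℂ, ℂ) := fun n ↦ ⟨fun z ↦ c n * z + w n, by fun_prop⟩ with hA_def
  have hA : ∀ n z, A n z = c n * z + w n := fun n z ↦ rfl
  have hAd : ∀ n, Differentiable ℂ (A n) := fun n ↦ by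
    simp only [funext (hA n)]
    fun_prop
  have hAi : ∀ n, Function.Injective (A n) := fun n ↦ by
    simp only [funext (hA n)]
    exact (add_left_injective (w n)).comp (mul_right_injective₀ (hc0 n))
  refine ⟨fun n ↦ (A n).comp (Ψ n), fun n ↦ ?_, fun n ↦ ?_, fun n ↦ ?_, fun n ↦ ?_, ?_⟩
  · rw [ContinuousMap.coe_comp]
    exact (hAd n).comp_differentiableOn (hd n)
  · rw [ContinuousMap.coe_comp]
    exact (hAi n).comp_injOn (hi n)
  · rw [ContinuousMap.comp_apply, hA]
    simp only [hw_def]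
    ring
  · rw [ContinuousMap.comp_apply, hA]
    simp only [hw_def]
    linear_combination hcq n
  · -- uniform convergence on `K`
    obtain ⟨M, hM⟩ := hK.exists_bound_of_continuousOn Φ.continuous.continuousOn
    have hcw : Tendsto (fun n ↦ ‖1 - c n‖ * (M + 1) + ‖w n‖) atTop (𝓝 0) := by
      have h := ((((tendsto_const_nhds : Tendsto (fun _ : ℕ ↦ (1 : ℂ)) atTop (𝓝 1))).sub
        hc1).norm.mul_const (M + 1)).add hw0.norm
      simpa using h
    rw [Metric.tendstoUniformlyOn_iff] at hunif ⊢
    intro ε hε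
    filter_upwards [hunif 1 one_pos, hunif (ε / 2) (half_pos hε),
      hcw.eventually (eventually_lt_nhds (half_pos hε))] with n hn1 hn2 hn3 x hx
    have hΨx : ‖Ψ n x‖ ≤ M + 1 :=
      calc ‖Ψ n x‖ ≤ ‖Φ x‖ + ‖Φ x - Ψ n x‖ := norm_le_norm_add_norm_sub (Φ x) (Ψ n x)
        _ ≤ M + 1 := add_le_add (hM x hx) (by rw [← dist_eq_norm]; exact (hn1 x hx).le)
    calc dist (Φ x) ((A n).comp (Ψ n) x)
        = ‖(Φ x - Ψ n x) + ((1 - c n) * Ψ n x - w n)‖ := by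
          rw [dist_eq_norm, ContinuousMap.comp_apply, hA]
          congr 1
          ring
      _ ≤ ‖Φ x - Ψ n x‖ + ‖(1 - c n) * Ψ n x - w n‖ := norm_add_le _ _
      _ ≤ ‖Φ x - Ψ n x‖ + (‖1 - c n‖ * (M + 1) + ‖w n‖) := add_le_add le_rfl (by
          calc ‖(1 - c n) * Ψ n x - w n‖ ≤ ‖(1 - c n) * Ψ n x‖ + ‖w n‖ := norm_sub_le _ _
            _ = ‖1 - c n‖ * ‖Ψ n x‖ + ‖w n‖ := by rw [norm_mul]
            _ ≤ ‖1 - c n‖ * (M + 1) + ‖w n‖ := by gcongr)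
      _ < ε / 2 + ε / 2 := add_lt_add (by rw [← dist_eq_norm]; exact hn2 x hx) hn3
      _ = ε := add_halves ε

/-- stub B2 (bookkeeping, M; Radó extension at the disc, direction-preserving form): for a chordal, Radó-continuous family, the direction-preserving transport identity for maps analytic and injective near the CLOSED unit disc extends to every direction-preserving `Φ : C(ℂ, ℂ)` complex differentiable on the open disc and injective on the closed disc. Approximants `Φₙ = Aₙ ∘ Φ (rₙ ·)`, `rₙ = 1 - 1/(n+2)`, with the complex-affine correction `Aₙ z = cₙ z + wₙ`, `cₙ = (Φ b - Φ a)/(Φ (rₙ b) - Φ (rₙ a)) → 1`, `wₙ = Φ a - cₙ Φ (rₙ a) → 0`, so that `Φₙ a = Φ a`, `Φₙ b = Φ b` for all `n` (hence `Φₙ` is direction-preserving with the same image marks); `Φₙ` is analytic and injective on the disc of radius `1/rₙ`, `Φₙ → Φ` uniformly on the closed disc; conclude by Radó continuity (`MarkedDomain.image` domains), dominated convergence on the compact traces and uniqueness of weak limits exactly as in p168392 (`Dichotomy.stub_radoExtensionDisc`). [folklore] -/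
theorem stub_radoExtensionDiscDP : ∀ P : Literature.Probability.RandomPlanarGeometry.ChordalFamily, P.IsChordal → P.IsRadoContinuous → (∀ (D₀ D' : Literature.Probability.RandomPlanarGeometry.DobrushinDomain) (Φ : C(ℂ, ℂ)) (U : Set ℂ), D₀.carrier = Metric.ball 0 1 → IsOpen U → closure D₀.carrier ⊆ U → DifferentiableOn ℂ Φ U → Set.InjOn Φ U → (∃ r : ℝ, 0 < r ∧ Φ (D₀.pt 1) - Φ (D₀.pt 0) = (r : ℂ) * (D₀.pt 1 - D₀.pt 0)) → D'.carrier = Φ '' D₀.carrier → D'.pt 0 = Φ (D₀.pt 0) → D'.pt 1 = Φ (D₀.pt 1) → P D' = (P D₀).map (Literature.Probability.RandomPlanarGeometry.CurveClass.map Φ)) → ∀ (D₀ D' : Literature.Probability.RandomPlanarGeometry.DobrushinDomain) (Φ : C(ℂ, ℂ)), D₀.carrier = Metric.ball 0 1 → DifferentiableOn ℂ Φ D₀.carrier → Set.InjOn Φ (closure D₀.carrier) → (∃ r : ℝ, 0 < r ∧ Φ (D₀.pt 1) - Φ (D₀.pt 0) = (r : ℂ) * (D₀.pt 1 - D₀.pt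 0)) → D'.carrier = Φ '' D₀.carrier → D'.pt 0 = Φ (D₀.pt 0) → D'.pt 1 = Φ (D₀.pt 1) → P D' = (P D₀).map (Literature.Probability.RandomPlanarGeometry.CurveClass.map Φ) := by
  intro P hch hRado hana D₀ D' Φ hball hΦd hΦi hr hD' h0 h1
  have hcl : closure D₀.carrier = closedBall (0 : ℂ) 1 := by
    rw [hball, closure_ball (0 : ℂ) one_ne_zero]
  -- the two marks: distinct points of the closed unit disc
  have hp : D₀.pt 0 ∈ closedBall (0 : ℂ) 1 := by
    rw [← hcl]
    exact frontier_subset_closure (D₀.pt_mem_frontier 0)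
  have hq : D₀.pt 1 ∈ closedBall (0 : ℂ) 1 := by
    rw [← hcl]
    exact frontier_subset_closure (D₀.pt_mem_frontier 1)
  have hpq : D₀.pt 0 ≠ D₀.pt 1 := fun h ↦ absurd (D₀.pt_injective h) (by decide)
  -- analytic dilates, then the affine re-pinning of the image marks
  obtain ⟨Ψ, U, hUo, hUsub, hΨd, hΨi, hΨunif⟩ := exists_dilates_closedBall Φ
    (by simpa only [hball] using hΦd) (by simpa only [hcl] using hΦi)
  obtain ⟨Φn, hd, hi, hfp, hfq, hunif⟩ := exists_pinned_approx Φ (isCompact_closedBall 0 1)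
    (by simpa only [hcl] using hΦi) hp hq hpq Ψ U hUsub hΨd hΨi hΨunif
  rw [← hcl] at hUsub hunif
  have hic : ∀ n, InjOn (Φn n) (closure D₀.carrier) := fun n ↦ (hi n).mono (hUsub n)
  have hdc : ∀ n, DifferentiableOn ℂ (Φn n) D₀.carrier := fun n ↦
    (hd n).mono (subset_closure.trans (hUsub n))
  -- each `Φₙ` is direction-preserving with the same ratio `r` (it has the same image marks)
  have hrn : ∀ n, ∃ r : ℝ, 0 < r ∧
      Φn n (D₀.pt 1) - Φn n (D₀.pt 0) = (r : ℂ) * (D₀.pt 1 - D₀.pt 0) := fun n ↦ by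
    rw [hfp n, hfq n]
    exact hr
  -- the laws of the image domains `Φₙ D₀` are the push-forwards (hypothesis: `Φₙ` is analytic
  -- and injective on the open neighbourhood `Uₙ` of the closed disc, direction-preserving)
  have hDn : ∀ n, P (D₀.image (Φn n) (Φn n).continuous.continuousOn (hic n)) =
      (P D₀).map (CurveClass.map (Φn n)) := fun n ↦
    hana D₀ _ (Φn n) (U n) hball (hUo n) (hUsub n) (hd n) (hi n) (hrn n) rfl rfl rfl
  haveI := (hch D').1
  haveI := (hch D₀).1
  haveI : IsProbabilityMeasure ((P D₀).map (CurveClass.map Φ)) :=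
    Measure.isProbabilityMeasure_map (CurveClass.measurable_map Φ).aemeasurable
  refine ext_of_forall_integral_eq_of_IsFiniteMeasure fun f ↦ ?_
  -- Radó continuity: `P (Φₙ D₀) ⇀ P D'`
  have hlim := hRado D₀ D' (fun n ↦ D₀.image (Φn n) (Φn n).continuous.continuousOn (hic n)) Φ Φn
    hunif hΦd hΦi (fun n ↦ ⟨hdc n, hic n⟩) hD' h0 h1 (fun _ ↦ ⟨rfl, rfl, rfl⟩) f
  simp only [hDn] at hlim
  -- dominated convergence: `(Φₙ)_* P D₀ ⇀ Φ_* P D₀`; limits are unique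
  exact tendsto_nhds_unique hlim
    (tendsto_integral_map_of_unif ((hch D₀).2.mono fun _ h ↦ h.2.2) hunif f)

end Summit.CriticalPhenomena.SAWScalingLimit.Cruxes.Rigidity.MarkFixing

end
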